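import Summits.AnomalousDissipation.AnomalousDissipation.Theorems.MarginalStabilityChainStrainedLayerLawStubMomentPairKernelKernels
import Literature.Analysis.FluidPDE.StretchedLayerStripCalculus

/-!
# Stub `stub_momentPairKernel` (crux stmt-AnomalousDissipation-3007) — tools B: strip integration and Fubini tools

Support file (`--supports stmt-AnomalousDissipation-3007`), second brick of `stub_momentPairKernel`
(`strainMoment = −½ pairForm ∘ vorticity`). Measure-theoretic tools on the period strip `(0, L] × ℝ` and on
`cell × cell`, all generic:

* `integral_strip_mul_dY_eq_neg_of_tendsto` — IBP in `y` across the layer when `f g` has the SAME limit at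
  `y → ±∞` on every slice (the fluxes cancel; Mathlib's whole-line `integral_mul_deriv_eq_deriv_mul` under Fubini);
* `setIntegral_strip_shift` — `∫_{(0,L]×ℝ} k(z − ζ) g(ζ) = ∫_{(−L/2,L/2]×ℝ} k(q) g(z − q)` for `L`-periodic `k, g`
  (the bridge from the line's cell `(0, L]` to the tools' centred strip `S_L`);
* `integral4_eq_integral_prod` — a continuous `H(x,y,x′,y′)` with a product majorant `a(y) b(y′)`, `a, b ∈ L¹`, is
  integrable on `((0,L]×ℝ)²` and its four-fold ITERATED integral is the product-measure integral (Fubini twice);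
* `tendsto_integral4_of_dominated`, `tendsto_integral2_of_dominated` — dominated convergence `ε → 0⁺` for four- and
  two-fold iterated integrals of continuous families with such majorants uniformly in `0 < ε ≤ 1`;
* integrability on the strip of (bounded kernel) × (field with exponential tails) and of
  (kernel decaying like `e^{−c|y − y′|}`) × (bounded field);
* the elementary consequences of the shear tails `SliceTails C k u v` (`0 ≤ C`, `|u| ≤ C + ½`, `|ω| ≤ C e^{−k|y|}`, …)
  and continuity of `∂ₓ`, `∂_y`, `ω` of `C²` fields.
Registered sub-goal proved here: `stub_momentPairKernel_stripIBPFlux`. All `[folklore]`.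
-/

-- `Summit.<Summit>.<Problem>` is the tree's mandated summit-side namespace (CONVENTIONS §2); for this
-- single-conjunct summit the two coincide, so the duplicate is deliberate.
set_option linter.dupNamespace false

noncomputable section

open scoped Topology
open Filter Set Function MeasureTheory Real

namespace Summit.AnomalousDissipation.AnomalousDissipation.Theorems.StrainedLayerLaw.StrainWorkSumRule

open Summit.AnomalousDissipation.AnomalousDissipation.Theorems.MarginalStabilityChainStretchedVortexRows
open Literature.Analysis.FluidPDE Literature.Analysis.FluidPDE.StretchedLayer

/-! ### Integration by parts in `y` with boundary fluxes -/

section StripTools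

variable {L : ℝ}

/-- **IBP in `y` across the layer with fluxes at infinity**: if on every slice `x` the product `f g` tends to
the SAME limit `l x` at `−∞` and at `+∞` (so the boundary terms cancel), and `f g′`, `f′ g` are integrable on the
strip, then `∫∫_{(0,L]×ℝ} f ∂_yg = −∫∫ ∂_yf g` (Fubini and Mathlib's whole-line `integral_mul_deriv_eq_deriv_mul`).
[folklore] -/
theorem integral_strip_mul_dY_eq_neg_of_tendsto {f g f' g' : ℝ → ℝ → ℝ} {l : ℝ → ℝ}
    (hf : ∀ x y, HasDerivAt (fun s => f x s) (f' x y) y)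
    (hg : ∀ x y, HasDerivAt (fun s => g x s) (g' x y) y)
    (hI1 : IntegrableOn (fun q : ℝ × ℝ => f q.1 q.2 * g' q.1 q.2) (Ioc 0 L ×ˢ univ))
    (hI2 : IntegrableOn (fun q : ℝ × ℝ => f' q.1 q.2 * g q.1 q.2) (Ioc 0 L ×ˢ univ))
    (hbot : ∀ x, Tendsto (fun y => f x y * g x y) atBot (𝓝 (l x)))
    (htop : ∀ x, Tendsto (fun y => f x y * g x y) atTop (𝓝 (l x))) :
    ∫ q in Ioc 0 L ×ˢ univ, f q.1 q.2 * g' q.1 q.2 =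
      -∫ q in Ioc 0 L ×ˢ univ, f' q.1 q.2 * g q.1 q.2 := by
  rw [IntegrableOn, volume_restrict_strip] at hI1 hI2
  rw [volume_restrict_strip, integral_prod _ hI1, integral_prod _ hI2, ← MeasureTheory.integral_neg]
  refine integral_congr_ae ?_
  filter_upwards [hI1.prod_right_ae, hI2.prod_right_ae] with x h1 h2
  have key := integral_mul_deriv_eq_deriv_mul (u := fun y => f x y) (v := fun y => g x y)
    (u' := fun y => f' x y) (v' := fun y => g' x y) (fun y _ => hf x y) (fun y _ => hg x y) h1 h2
    (hbot x) (htop x)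
  rw [sub_self, zero_sub] at key
  exact key

/-- **Shifting the cell**: for `L`-periodic (in the first variable) `k`, `g`,
`∫_{(0,L]×ℝ} k(x − x′, y − y′) g(x′, y′) = ∫_{(−L/2,L/2]×ℝ} k(q) g(x − q₁, y − q₂)` (both integrands integrable):
translation/reflection invariance of Lebesgue measure in `y′` and the shift-invariance of the period integral of a
periodic function. [folklore] -/
theorem setIntegral_strip_shift (hL : 0 < L) {k g : ℝ → ℝ → ℝ} (x y : ℝ)
    (hkper : ∀ a b, k (a + L) b = k a b) (hgper : ∀ a b, g (a + L) b = g a b)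
    (hI : IntegrableOn (fun q : ℝ × ℝ => k (x - q.1) (y - q.2) * g q.1 q.2) (Ioc 0 L ×ˢ univ))
    (hI' : IntegrableOn (fun q : ℝ × ℝ => k q.1 q.2 * g (x - q.1) (y - q.2))
      (Ioc (-(L / 2)) (L / 2) ×ˢ univ)) :
    ∫ q in Ioc 0 L ×ˢ univ, k (x - q.1) (y - q.2) * g q.1 q.2 =
      ∫ q in Ioc (-(L / 2)) (L / 2) ×ˢ univ, k q.1 q.2 * g (x - q.1) (y - q.2) := by
  set Φ : ℝ → ℝ := fun x' => ∫ y', k (x - x') (y - y') * g x' y' with hΦdef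
  have hΦ : Function.Periodic Φ L := fun x' => by
    simp only [hΦdef]
    refine integral_congr_ae (Eventually.of_forall fun y' => ?_)
    show k (x - (x' + L)) (y - y') * g (x' + L) y' = k (x - x') (y - y') * g x' y'
    rw [hgper, show x - (x' + L) = x - x' - L by ring, ← hkper (x - x' - L), sub_add_cancel]
  rw [IntegrableOn, volume_restrict_strip] at hI
  rw [IntegrableOn, RowBiotSavart.volume_restrict_strip] at hI'
  rw [volume_restrict_strip, integral_prod _ hI, RowBiotSavart.volume_restrict_strip, integral_prod _ hI']
  have hinner : ∀ q₁, (∫ q₂, k q₁ q₂ * g (x - q₁) (y - q₂)) = Φ (x - q₁) := fun q₁ => by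
    simp only [hΦdef, sub_sub_cancel]
    rw [← integral_sub_left_eq_self (fun q₂ => k q₁ q₂ * g (x - q₁) (y - q₂)) volume y]
    simp only [sub_sub_cancel]
  have hL' : ∀ x', (∫ y', k (x - x') (y - y') * g x' y') = Φ x' := fun x' => rfl
  simp only [hinner, hL']
  rw [← intervalIntegral.integral_of_le hL.le, ← intervalIntegral.integral_of_le (by linarith : -(L / 2) ≤ L / 2),
    intervalIntegral.integral_comp_sub_left (fun s => Φ s) x, show x - -(L / 2) = x - L / 2 + L by ring,
    hΦ.intervalIntegral_add_eq (x - L / 2) 0, zero_add]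

/-! ### Four-fold iterated integrals over `cell × cell` -/

/-- **Product-dominated continuous integrands on `cell × cell`**: if `H` is continuous on `(ℝ²)²` and
`|H(x,y,x′,y′)| ≤ a(y) b(y′)` with `a, b ∈ L¹(ℝ)`, then `H` is integrable on `((0,L]×ℝ)²` and the four-fold
iterated integral equals the integral over the product measure (Fubini twice). [folklore] -/
theorem integral4_eq_integral_prod {H : ℝ → ℝ → ℝ → ℝ → ℝ}
    (hH : Continuous fun p : (ℝ × ℝ) × (ℝ × ℝ) => H p.1.1 p.1.2 p.2.1 p.2.2)
    {a b : ℝ → ℝ} (ha : Integrable a) (hb : Integrable b)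
    (hle : ∀ x y x' y', |H x y x' y'| ≤ a y * b y') (L : ℝ) :
    Integrable (fun p : (ℝ × ℝ) × (ℝ × ℝ) => H p.1.1 p.1.2 p.2.1 p.2.2)
        (((volume.restrict (Ioc 0 L)).prod volume).prod ((volume.restrict (Ioc 0 L)).prod volume)) ∧
      ∫ x in Ioc 0 L, ∫ y, ∫ x' in Ioc 0 L, ∫ y', H x y x' y' =
        ∫ p, H p.1.1 p.1.2 p.2.1 p.2.2
          ∂(((volume.restrict (Ioc 0 L)).prod volume).prod ((volume.restrict (Ioc 0 L)).prod volume)) := by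
  set μ : Measure (ℝ × ℝ) := (volume.restrict (Ioc 0 L)).prod volume
  have hA : Integrable (fun z : ℝ × ℝ => a z.2) μ := ha.comp_snd _
  have hB : Integrable (fun z : ℝ × ℝ => b z.2) μ := hb.comp_snd _
  have hint : Integrable (fun p : (ℝ × ℝ) × (ℝ × ℝ) => H p.1.1 p.1.2 p.2.1 p.2.2) (μ.prod μ) := by
    refine (hA.mul_prod hB).mono' hH.aestronglyMeasurable (Eventually.of_forall fun p => ?_)
    rw [Real.norm_eq_abs]; exact hle _ _ _ _
  refine ⟨hint, ?_⟩
  have hsec : ∀ x y, Integrable (fun z' : ℝ × ℝ => H x y z'.1 z'.2) μ := fun x y => by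
    refine (hB.const_mul (a y)).mono' ?_ (Eventually.of_forall fun z' => ?_)
    · have hc : Continuous fun z' : ℝ × ℝ => H x y z'.1 z'.2 :=
        hH.comp ((continuous_const (y := (x, y))).prodMk continuous_id)
      exact hc.aestronglyMeasurable
    · rw [Real.norm_eq_abs]; exact hle _ _ _ _
  have h1 : ∀ x y, ∫ x' in Ioc 0 L, ∫ y', H x y x' y' = ∫ z', H x y z'.1 z'.2 ∂μ := fun x y =>
    integral_integral (hsec x y)
  simp only [h1]
  rw [integral_prod _ hint]
  exact integral_integral (f := fun x y => ∫ z', H x y z'.1 z'.2 ∂μ) hint.integral_prod_left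

/-- Positivity of measures of the strip normalisation: `(volume.restrict (0,L]).real univ = L` for `L ≥ 0`.
[folklore] -/
theorem restrict_Ioc_real_univ (hL : 0 ≤ L) : ((volume : Measure ℝ).restrict (Ioc 0 L)).real univ = L := by
  rw [measureReal_restrict_apply_univ, Real.volume_real_Ioc_of_le hL, sub_zero]

/-- **Dominated convergence for four-fold iterated integrals over `cell × cell`**: a family `H ε` of continuous
integrands with a product majorant `a(y) b(y′)` (`a, b ∈ L¹`) uniformly in `0 < ε ≤ 1`, converging pointwise
everywhere as `ε → 0⁺`, has converging four-fold iterated integrals (four nested dominated convergences; the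
inner integrals are measurable by `StronglyMeasurable.integral_prod_right`). [folklore] -/
theorem tendsto_integral4_of_dominated (hL : 0 ≤ L) {H : ℝ → ℝ → ℝ → ℝ → ℝ → ℝ} {H0 : ℝ → ℝ → ℝ → ℝ → ℝ}
    (hH : ∀ ε, 0 < ε → ε ≤ 1 → Continuous fun p : (ℝ × ℝ) × (ℝ × ℝ) => H ε p.1.1 p.1.2 p.2.1 p.2.2)
    {a b : ℝ → ℝ} (ha : Integrable a) (hb : Integrable b)
    (hle : ∀ ε, 0 < ε → ε ≤ 1 → ∀ x y x' y', |H ε x y x' y'| ≤ a y * b y')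
    (hlim : ∀ x y x' y', Tendsto (fun ε => H ε x y x' y') (𝓝[>] 0) (𝓝 (H0 x y x' y'))) :
    Tendsto (fun ε => ∫ x in Ioc 0 L, ∫ y, ∫ x' in Ioc 0 L, ∫ y', H ε x y x' y') (𝓝[>] 0)
      (𝓝 (∫ x in Ioc 0 L, ∫ y, ∫ x' in Ioc 0 L, ∫ y', H0 x y x' y')) := by
  have hev : ∀ᶠ ε in 𝓝[>] (0:ℝ), 0 < ε ∧ ε ≤ 1 := by
    filter_upwards [Ioc_mem_nhdsGT one_pos] with ε hε using hε
  set B : ℝ := ∫ y', b y'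
  set A : ℝ := ∫ y, a y
  -- level 4 (innermost, `y′`)
  have L4 : ∀ x y x', Tendsto (fun ε => ∫ y', H ε x y x' y') (𝓝[>] 0) (𝓝 (∫ y', H0 x y x' y')) := by
    intro x y x'
    refine tendsto_integral_filter_of_dominated_convergence (fun y' => a y * b y') ?_ ?_ (hb.const_mul _) ?_
    · filter_upwards [hev] with ε hε
      have hc : Continuous fun y' : ℝ => H ε x y x' y' :=
        (hH ε hε.1 hε.2).comp ((continuous_const (y := (x, y))).prodMk ((continuous_const (y := x')).prodMk
          continuous_id))
      exact hc.aestronglyMeasurable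
    · filter_upwards [hev] with ε hε
      exact Eventually.of_forall fun y' => (Real.norm_eq_abs _).le.trans (hle ε hε.1 hε.2 x y x' y')
    · exact Eventually.of_forall fun y' => hlim x y x' y'
  have B4 : ∀ ε, 0 < ε → ε ≤ 1 → ∀ x y x', ‖∫ y', H ε x y x' y'‖ ≤ a y * B := by
    intro ε hε hε1 x y x'
    calc ‖∫ y', H ε x y x' y'‖ ≤ ∫ y', ‖H ε x y x' y'‖ := norm_integral_le_integral_norm _
      _ ≤ ∫ y', a y * b y' := integral_mono_of_nonneg (Eventually.of_forall fun _ => norm_nonneg _)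
          (hb.const_mul _) (Eventually.of_forall fun y' => (Real.norm_eq_abs _).le.trans (hle ε hε hε1 x y x' y'))
      _ = a y * B := integral_const_mul _ _
  -- level 3 (`x′ ∈ (0,L]`)
  have M3 : ∀ ε, 0 < ε → ε ≤ 1 → ∀ x y, AEStronglyMeasurable (fun x' => ∫ y', H ε x y x' y')
      ((volume : Measure ℝ).restrict (Ioc 0 L)) := by
    intro ε hε hε1 x y
    have hc : Continuous (uncurry fun x' y' => H ε x y x' y') :=
      (hH ε hε hε1).comp ((continuous_const (y := (x, y))).prodMk continuous_id)
    exact (hc.stronglyMeasurable.integral_prod_right (ν := volume)).aestronglyMeasurable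
  have L3 : ∀ x y, Tendsto (fun ε => ∫ x' in Ioc 0 L, ∫ y', H ε x y x' y') (𝓝[>] 0)
      (𝓝 (∫ x' in Ioc 0 L, ∫ y', H0 x y x' y')) := by
    intro x y
    refine tendsto_integral_filter_of_dominated_convergence (fun _ => a y * B) ?_ ?_ (integrable_const _) ?_
    · filter_upwards [hev] with ε hε; exact M3 ε hε.1 hε.2 x y
    · filter_upwards [hev] with ε hε; exact Eventually.of_forall fun x' => B4 ε hε.1 hε.2 x y x'
    · exact Eventually.of_forall fun x' => L4 x y x'
  have B3 : ∀ ε, 0 < ε → ε ≤ 1 → ∀ x y, ‖∫ x' in Ioc 0 L, ∫ y', H ε x y x' y'‖ ≤ a y * B * L := by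
    intro ε hε hε1 x y
    have h := norm_integral_le_of_norm_le_const (μ := (volume : Measure ℝ).restrict (Ioc 0 L))
      (Eventually.of_forall fun x' => B4 ε hε hε1 x y x')
    rwa [restrict_Ioc_real_univ hL] at h
  -- level 2 (`y`)
  have M2 : ∀ ε, 0 < ε → ε ≤ 1 → ∀ x, AEStronglyMeasurable (fun y => ∫ x' in Ioc 0 L, ∫ y', H ε x y x' y')
      (volume : Measure ℝ) := by
    intro ε hε hε1 x
    have hc : Continuous (uncurry fun (p : ℝ × ℝ) (y' : ℝ) => H ε x p.1 p.2 y') :=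
      (hH ε hε hε1).comp (((continuous_const (y := x)).prodMk (continuous_fst.comp continuous_fst)).prodMk
        ((continuous_snd.comp continuous_fst).prodMk continuous_snd))
    have hm : StronglyMeasurable (uncurry fun y x' => ∫ y', H ε x y x' y') :=
      hc.stronglyMeasurable.integral_prod_right (ν := volume)
    exact (hm.integral_prod_right (ν := (volume : Measure ℝ).restrict (Ioc 0 L))).aestronglyMeasurable
  have L2 : ∀ x, Tendsto (fun ε => ∫ y, ∫ x' in Ioc 0 L, ∫ y', H ε x y x' y') (𝓝[>] 0)
      (𝓝 (∫ y, ∫ x' in Ioc 0 L, ∫ y', H0 x y x' y')) := by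
    intro x
    refine tendsto_integral_filter_of_dominated_convergence (fun y => a y * B * L) ?_ ?_
      ((ha.mul_const _).mul_const _) ?_
    · filter_upwards [hev] with ε hε; exact M2 ε hε.1 hε.2 x
    · filter_upwards [hev] with ε hε; exact Eventually.of_forall fun y => B3 ε hε.1 hε.2 x y
    · exact Eventually.of_forall fun y => L3 x y
  have B2 : ∀ ε, 0 < ε → ε ≤ 1 → ∀ x, ‖∫ y, ∫ x' in Ioc 0 L, ∫ y', H ε x y x' y'‖ ≤ A * B * L := by
    intro ε hε hε1 x
    calc ‖∫ y, ∫ x' in Ioc 0 L, ∫ y', H ε x y x' y'‖ ≤ ∫ y, ‖∫ x' in Ioc 0 L, ∫ y', H ε x y x' y'‖ :=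
          norm_integral_le_integral_norm _
      _ ≤ ∫ y, a y * B * L := integral_mono_of_nonneg (Eventually.of_forall fun _ => norm_nonneg _)
          ((ha.mul_const _).mul_const _) (Eventually.of_forall fun y => B3 ε hε hε1 x y)
      _ = A * B * L := by rw [integral_mul_const, integral_mul_const]
  -- level 1 (`x ∈ (0,L]`)
  have M1 : ∀ ε, 0 < ε → ε ≤ 1 → AEStronglyMeasurable (fun x => ∫ y, ∫ x' in Ioc 0 L, ∫ y', H ε x y x' y')
      ((volume : Measure ℝ).restrict (Ioc 0 L)) := by
    intro ε hε hε1
    have hc : Continuous (uncurry fun (q : (ℝ × ℝ) × ℝ) (y' : ℝ) => H ε q.1.1 q.1.2 q.2 y') :=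
      (hH ε hε hε1).comp ((continuous_fst.comp continuous_fst).prodMk
        ((continuous_snd.comp continuous_fst).prodMk continuous_snd))
    have hm3 : StronglyMeasurable (uncurry fun (z : ℝ × ℝ) (x' : ℝ) => ∫ y', H ε z.1 z.2 x' y') :=
      hc.stronglyMeasurable.integral_prod_right (ν := volume)
    have hm2 : StronglyMeasurable (uncurry fun x y => ∫ x' in Ioc 0 L, ∫ y', H ε x y x' y') :=
      hm3.integral_prod_right (ν := (volume : Measure ℝ).restrict (Ioc 0 L))
    exact (hm2.integral_prod_right (ν := volume)).aestronglyMeasurable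
  refine tendsto_integral_filter_of_dominated_convergence (fun _ => A * B * L) ?_ ?_ (integrable_const _) ?_
  · filter_upwards [hev] with ε hε; exact M1 ε hε.1 hε.2
  · filter_upwards [hev] with ε hε; exact Eventually.of_forall fun x => B2 ε hε.1 hε.2 x
  · exact Eventually.of_forall fun x => L2 x

/-- **Dominated convergence for two-fold iterated integrals over the cell** (same mechanism, two levels).
[folklore] -/
theorem tendsto_integral2_of_dominated {G : ℝ → ℝ → ℝ → ℝ} {G0 : ℝ → ℝ → ℝ}
    (hG : ∀ ε, 0 < ε → ε ≤ 1 → Continuous fun p : ℝ × ℝ => G ε p.1 p.2)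
    {a : ℝ → ℝ} (ha : Integrable a) (hle : ∀ ε, 0 < ε → ε ≤ 1 → ∀ x y, |G ε x y| ≤ a y)
    (hlim : ∀ x y, Tendsto (fun ε => G ε x y) (𝓝[>] 0) (𝓝 (G0 x y))) (L : ℝ) :
    Tendsto (fun ε => ∫ x in Ioc 0 L, ∫ y, G ε x y) (𝓝[>] 0) (𝓝 (∫ x in Ioc 0 L, ∫ y, G0 x y)) := by
  have hev : ∀ᶠ ε in 𝓝[>] (0:ℝ), 0 < ε ∧ ε ≤ 1 := by
    filter_upwards [Ioc_mem_nhdsGT one_pos] with ε hε using hε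
  have L2 : ∀ x, Tendsto (fun ε => ∫ y, G ε x y) (𝓝[>] 0) (𝓝 (∫ y, G0 x y)) := by
    intro x
    refine tendsto_integral_filter_of_dominated_convergence a ?_ ?_ ha ?_
    · filter_upwards [hev] with ε hε
      exact ((hG ε hε.1 hε.2).comp ((continuous_const (y := x)).prodMk continuous_id)).aestronglyMeasurable
    · filter_upwards [hev] with ε hε
      exact Eventually.of_forall fun y => (Real.norm_eq_abs _).le.trans (hle ε hε.1 hε.2 x y)
    · exact Eventually.of_forall fun y => hlim x y
  refine tendsto_integral_filter_of_dominated_convergence (fun _ => ∫ y, a y) ?_ ?_ (integrable_const _) ?_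
  · filter_upwards [hev] with ε hε
    exact ((hG ε hε.1 hε.2).stronglyMeasurable.integral_prod_right' (ν := volume)).aestronglyMeasurable
  · filter_upwards [hev] with ε hε
    refine Eventually.of_forall fun x => ?_
    calc ‖∫ y, G ε x y‖ ≤ ∫ y, ‖G ε x y‖ := norm_integral_le_integral_norm _
      _ ≤ ∫ y, a y := integral_mono_of_nonneg (Eventually.of_forall fun _ => norm_nonneg _) ha
          (Eventually.of_forall fun y => (Real.norm_eq_abs _).le.trans (hle ε hε.1 hε.2 x y))
  · exact Eventually.of_forall fun x => L2 x

end StripTools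

/-! ### Integrability on the strip: kernel × field -/

section KerField

variable {L k C : ℝ}

/-- A continuous bounded kernel times a continuous field with exponential tails is integrable on the strip.
[folklore] -/
theorem integrableOn_strip_bdd_mul_decay (hk : 0 < k) {K w : ℝ → ℝ → ℝ}
    (hKc : Continuous fun p : ℝ × ℝ => K p.1 p.2) (hwc : Continuous fun p : ℝ × ℝ => w p.1 p.2)
    {A : ℝ} (hK : ∀ a b, |K a b| ≤ A) (hC : 0 ≤ C) (hw : ∀ a b, |w a b| ≤ C * Real.exp (-k * |b|)) :
    IntegrableOn (fun q : ℝ × ℝ => K q.1 q.2 * w q.1 q.2) (Ioc 0 L ×ˢ univ) := by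
  have hA : 0 ≤ A := (abs_nonneg _).trans (hK 0 0)
  refine integrableOn_strip_of_abs_le_exp (hKc.mul hwc) (mul_nonneg hA hC) hk fun a _ b => ?_
  rw [abs_mul, mul_assoc]
  exact mul_le_mul (hK a b) (hw a b) (abs_nonneg _) hA

/-- A continuous field with exponential tails times a continuous bounded kernel is integrable on the strip.
[folklore] -/
theorem integrableOn_strip_decay_mul_bdd (hk : 0 < k) {K w : ℝ → ℝ → ℝ}
    (hKc : Continuous fun p : ℝ × ℝ => K p.1 p.2) (hwc : Continuous fun p : ℝ × ℝ => w p.1 p.2)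
    {A : ℝ} (hK : ∀ a b, |K a b| ≤ A) (hC : 0 ≤ C) (hw : ∀ a b, |w a b| ≤ C * Real.exp (-k * |b|)) :
    IntegrableOn (fun q : ℝ × ℝ => w q.1 q.2 * K q.1 q.2) (Ioc 0 L ×ˢ univ) := by
  have h := integrableOn_strip_bdd_mul_decay hk hKc hwc hK hC hw (L := L)
  refine h.congr_fun (fun q _ => ?_) (measurableSet_Ioc.prod MeasurableSet.univ)
  exact mul_comm _ _

/-- A continuous kernel decaying like `A e^{−c|y − y′|}` times a continuous bounded field is integrable on the
strip. [folklore] -/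
theorem integrableOn_strip_decayKer_mul_bdd {K w : ℝ → ℝ → ℝ}
    (hKc : Continuous fun p : ℝ × ℝ => K p.1 p.2) (hwc : Continuous fun p : ℝ × ℝ => w p.1 p.2)
    {A c M : ℝ} (hc : 0 < c) (y : ℝ) (hK : ∀ a b, |K a b| ≤ A * Real.exp (-c * |y - b|))
    (hw : ∀ a b, |w a b| ≤ M) :
    IntegrableOn (fun q : ℝ × ℝ => K q.1 q.2 * w q.1 q.2) (Ioc 0 L ×ˢ univ) := by
  have hA : 0 ≤ A := by
    have := (abs_nonneg _).trans (hK 0 y); simpa using this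
  have hM : 0 ≤ M := (abs_nonneg _).trans (hw 0 0)
  refine integrableOn_strip_of_abs_le (hKc.mul hwc)
    (((MarginalStabilityChainBurgersLayerLowRe.integrable_kernel hc y).const_mul A).mul_const M) fun a _ b => ?_
  rw [abs_mul]
  calc |K a b| * |w a b| ≤ A * Real.exp (-c * |y - b|) * M :=
        mul_le_mul (hK a b) (hw a b) (abs_nonneg _) (by positivity)
    _ = A * Real.exp (-(c * |y - b|)) * M := by rw [neg_mul]

end KerField

/-! ### Elementary consequences of the shear tails and of `C²` regularity -/

section TailFacts

variable {C k : ℝ} {u v : ℝ → ℝ → ℝ}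

/-- `0 ≤ C`. [folklore] -/
theorem tails_C_nonneg (hT : SliceTails C k u v) : 0 ≤ C := by
  have := (hT 0 0).2.1
  simp only [abs_zero, mul_zero, Real.exp_zero, mul_one] at this
  exact (abs_nonneg _).trans this

/-- `|v| ≤ C e^{−k|y|}`. [folklore] -/
theorem tails_abs_v_le (hT : SliceTails C k u v) (x y : ℝ) : |v x y| ≤ C * Real.exp (-k * |y|) := (hT x y).2.1

/-- `|u| ≤ C + ½` (`k > 0`). [folklore] -/
theorem tails_abs_u_le (hT : SliceTails C k u v) (hk : 0 < k) (x y : ℝ) : |u x y| ≤ C + 1 / 2 := by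
  have h1 := (abs_le.1 (hT x y).1).2
  have hC := tails_C_nonneg hT
  have he : Real.exp (-k * |y|) ≤ 1 := Real.exp_le_one_iff.2 (by nlinarith [abs_nonneg y])
  have h2 : u x y ^ 2 ≤ (C + 1 / 2) ^ 2 := by
    nlinarith [sq_nonneg (v x y), mul_le_mul_of_nonneg_left he hC]
  exact (sq_le_sq.1 h2).trans (abs_of_nonneg (by linarith)).le

/-- `|∂ₓu| ≤ C e^{−k|y|}`. [folklore] -/
theorem tails_abs_dXu_le (hT : SliceTails C k u v) (x y : ℝ) : |dX u x y| ≤ C * Real.exp (-k * |y|) := by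
  have := (hT x y).2.2.1
  linarith [abs_nonneg (dY u x y), abs_nonneg (dX v x y), abs_nonneg (dY v x y)]

/-- `|∂_yu| ≤ C e^{−k|y|}`. [folklore] -/
theorem tails_abs_dYu_le (hT : SliceTails C k u v) (x y : ℝ) : |dY u x y| ≤ C * Real.exp (-k * |y|) := by
  have := (hT x y).2.2.1
  linarith [abs_nonneg (dX u x y), abs_nonneg (dX v x y), abs_nonneg (dY v x y)]

/-- `|∂ₓv| ≤ C e^{−k|y|}`. [folklore] -/
theorem tails_abs_dXv_le (hT : SliceTails C k u v) (x y : ℝ) : |dX v x y| ≤ C * Real.exp (-k * |y|) := by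
  have := (hT x y).2.2.1
  linarith [abs_nonneg (dX u x y), abs_nonneg (dY u x y), abs_nonneg (dY v x y)]

/-- `|∂_yv| ≤ C e^{−k|y|}`. [folklore] -/
theorem tails_abs_dYv_le (hT : SliceTails C k u v) (x y : ℝ) : |dY v x y| ≤ C * Real.exp (-k * |y|) := by
  have := (hT x y).2.2.1
  linarith [abs_nonneg (dX u x y), abs_nonneg (dY u x y), abs_nonneg (dX v x y)]

/-- `|ω| ≤ C e^{−k|y|}`. [folklore] -/
theorem tails_abs_vorticity_le (hT : SliceTails C k u v) (x y : ℝ) : |vorticity u v x y| ≤ C * Real.exp (-k * |y|) := by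
  have := (hT x y).2.2.1
  unfold vorticity
  calc |dX v x y - dY u x y| ≤ |dX v x y| + |dY u x y| := abs_sub _ _
    _ ≤ _ := by linarith [abs_nonneg (dX u x y), abs_nonneg (dY v x y)]

/-- `∂ₓ` of a `C²` field is continuous. [folklore] -/
theorem contDX (hu : ContDiff ℝ 2 (fun q : ℝ × ℝ => u q.1 q.2)) : Continuous fun p : ℝ × ℝ => dX u p.1 p.2 :=
  continuous_dX (hu.of_le one_le_two)

/-- `∂_y` of a `C²` field is continuous. [folklore] -/
theorem contDY (hu : ContDiff ℝ 2 (fun q : ℝ × ℝ => u q.1 q.2)) : Continuous fun p : ℝ × ℝ => dY u p.1 p.2 :=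
  continuous_dY (hu.of_le one_le_two)

/-- `ω` of a `C²` pair is continuous. [folklore] -/
theorem continuous_vorticity (hu : ContDiff ℝ 2 (fun q : ℝ × ℝ => u q.1 q.2))
    (hv : ContDiff ℝ 2 (fun q : ℝ × ℝ => v q.1 q.2)) : Continuous fun p : ℝ × ℝ => vorticity u v p.1 p.2 := by
  unfold vorticity; exact (contDX hv).sub (contDY hu)

end TailFacts


/-- **Integration by parts in `y` across the layer with fluxes at infinity** (registered on
stmt-AnomalousDissipation-3007 as the helper sub-goal `stub_momentPairKernel_stripIBPFlux` of `stub_momentPairKernel`):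
if on every slice the product `f g` tends to the same limit at `y → −∞` and `y → +∞` (the boundary fluxes cancel)
and `f ∂_yg`, `∂_yf g` are integrable on the period strip, then `∫∫ f ∂_yg = −∫∫ ∂_yf g`
(`integral_strip_mul_dY_eq_neg_of_tendsto`). [folklore] -/
theorem stub_momentPairKernel_stripIBPFlux : ∀ (L : ℝ) (f g f' g' : ℝ → ℝ → ℝ) (l : ℝ → ℝ),
    (∀ x y, HasDerivAt (fun s => f x s) (f' x y) y) → (∀ x y, HasDerivAt (fun s => g x s) (g' x y) y) →
    IntegrableOn (fun q : ℝ × ℝ => f q.1 q.2 * g' q.1 q.2) (Ioc 0 L ×ˢ univ) →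
    IntegrableOn (fun q : ℝ × ℝ => f' q.1 q.2 * g q.1 q.2) (Ioc 0 L ×ˢ univ) →
    (∀ x, Tendsto (fun y => f x y * g x y) atBot (𝓝 (l x))) →
    (∀ x, Tendsto (fun y => f x y * g x y) atTop (𝓝 (l x))) →
      ∫ q in Ioc 0 L ×ˢ univ, f q.1 q.2 * g' q.1 q.2 = -∫ q in Ioc 0 L ×ˢ univ, f' q.1 q.2 * g q.1 q.2 :=
  fun _ _ _ _ _ _ hf hg hI1 hI2 hbot htop => integral_strip_mul_dY_eq_neg_of_tendsto hf hg hI1 hI2 hbot htop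

end Summit.AnomalousDissipation.AnomalousDissipation.Theorems.StrainedLayerLaw.StrainWorkSumRule

end
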